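import Summits.QuantumFields.BalabanUV.Beta.D1BFx.RProjectorRange

/-!
# `BalabanUV.Beta.D1BFx.ProjectorKernelIdentities` — road «BF-x» for binder row D1, slot (K), debt X₁a, brick **Q3a** of `X1-SPEC.md`:
# THE ℤ^d KERNEL IDENTITIES OF THE GAUGE PROJECTOR `P` THAT CHARACTERISE IT — `P·(G′Q′*) = G′Q′*` (with `P² = P`, `Pᵀ = P` imported), and
# **`P·Δ^η` FACTORS THROUGH THE BLOCK OF ITS COLUMN** (so `P·Δ^η λ = 0` for block-mean-free `λ`), all as absolutely convergent kernel identities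

HONEST FRAMING (cell contract, verbatim): «discharging `BetaPertH` makes Bałaban's UV stability UNCONDITIONAL — a real constructive-QFT
result; it is NOT the continuum limit and NOT the Clay problem.»  HONEST DEPENDENCY (verbatim): «continuum YM on T⁴ ⇐ BetaPertH ∧ nine
spine estimates (0/9 proved); BetaPertH ⇐ (D1) ∧ (D4) ∧ CAP+tail; G-an2-4 gates asym, D1 and NE2/3/4.»  THIS MODULE DISCHARGES NOTHING of
D1 / BetaPertH: [folklore] kernel algebra over pv23's typed whole-lattice objects (`B6QGQLower276.AX/lapKer/sameBlk/blk/B`, `B5Hk103ScalarZd.gq/nbhd`,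
`RProjector.kerP/Pker` with `sum_AX_mul_Pker`, `Pker_symm`, `RProjectorRange.tsum_gq_mul_Pker`, `tsum_Pker_mul_Pker`) USED BY NAME.  One data
`def` with a body (`lapRow`, the explicit coarse-factored row — [our object], not a `Prop`); nothing is cited; 0 sorry.  NOT summit progress; NOT
BetaPertH, NOT continuum, NOT Clay.

ABSOLUTE RULE (cell, verbatim): «No internally-minted statement may enter as a cited fact. Every hypothesis is either kernel-proved in this
package or a verbatim quotation of a PUBLISHED theorem with page reference. The manuscript(s) under audit are NOT citable for their own
disputed steps — they are the thing under adjudication; programme-internal (2001/route/tribunal) claims are never citable.»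

WHY (`HOME/b2b-balaban-beta-d1-p2/X1-SPEC.md` v1 §1, brick Q3a; owner claim journal 2026-08-20T18:44Z).  Debt X₁a of slot (K) (`Δ_a·Ga = δ` on `ℤ⁴`
for `Ga = Kinf`) is reached on the PERIODISATION ROAD: per torus, an5's `DeltaA` must be recognised as the periodisation of the road's `ℤ⁴` operator,
whose non-local part is the gauge projector `P = Pker` of `RProjector` (B9 (3.25) form `G′Q′*(Q′G′²Q′*)⁻¹Q′G′`, CONTEXT ONLY), while an5 types B5's
(1.26)/(1.70) form `Δ⁻¹Q′*(Q′Δ⁻²Q′*)⁻¹Q′Δ⁻¹` (`B5Value126.PcT`).  The two are compared (brick Q3b/Q3c) through the CHARACTERISATION of `1 − P` as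
the orthogonal projector onto `Δ^η N(Q′)`: `P` is symmetric and idempotent, fixes the columns of `G′Q′*`, and KILLS `Δ^η λ` for every `λ` with
vanishing block sums.  The first three are in the tree; the fourth is there only in the weak form for finitely supported `λ`
(`RProjector.sum_Pker_mul_lap_eq_zero`).  What the periodised (torus) argument consumes is the KERNEL-LEVEL statement behind it — the row
`(P·Δ^η)(p, r)` is an explicit function of `p` and of the BLOCK `blk r` only — because that shape survives `periodise₂` (product rule
`EntrywiseVolumeLimit.periodise₂_compKer`) verbatim.  This file isolates exactly that.

CONTENT (every `d`, block side `n + 1`, `a > 0`; all [folklore] / [our object]).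
* §1 `sum_Pker_mul_AX` (`Σ_{q ∈ nbhd r} P(p,q)·Δ′_a(q,r) = (n+1)^{−d}·(G′Q′*C)(p, blk r)` — `sum_AX_mul_Pker` read from the other side),
  `sum_Pker_mul_sameBlk` (`Σ_{q ∈ nbhd r} P(p,q)·1[blk q = blk r] = Σ_{q ∈ B(blk r)} P(p,q)`), the explicit row `lapRow n a p y`, and
  **`sum_Pker_mul_lapKer : Σ_{q ∈ nbhd r} P(p,q)·(−Δ)(q,r) = lapRow n a p (blk n r)`**; window and `tsum` forms (`sum_Pker_mul_lapKer_of_subset`,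
  `tsum_Pker_mul_lapKer`), and the block-constancy corollary `tsum_Pker_mul_lapKer_eq_of_blk_eq`.
* §2 the operator corollary for finitely supported block-mean-free `λ`: `sum_tsum_Pker_mul_lapKer_mul_eq_zero` (`Σ_r (PΔ)(p,r)·λ(r) = 0`).
* §3 the companion in the same left-acting shape: `tsum_Pker_mul_gq` (`Σ'_q P(p,q)·(G′Q′*)(q,y) = (G′Q′*)(p,y)`), and row summability
  `summable_Pker_row` / `summable_abs_Pker_row`; `P² = P` and `Pᵀ = P` are `RProjectorRange.tsum_Pker_mul_Pker` / `RProjector.Pker_symm`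
  (imported here, not restated), so that brick Q3b imports ONE module.
Unit `b2b-balaban-beta-d1-p2` (road owner, gen 5).
-/

namespace Summit.QuantumFields.BalabanUV.Beta.D1BFx.ProjectorKernelIdentities

open Finset
open scoped BigOperators
open Literature.MathematicalPhysics.QuantumFieldTheory.Balaban1983to89
open B6QGQLower276 (X blk B mem_B lapKer sameBlk AX AX_symm lapKer_symm)
open B5Hk103ScalarZd (gq nbhd lapKer_eq_zero_of_not_mem sum_mul_blockConst_eq_zero)
open Summit.QuantumFields.BalabanUV.Beta.D1BFx.RProjector (kerP Pker Pker_symm sum_AX_mul_Pker summable_Pker abs_Pker_le deltaPP deltaPP_pos)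
open Summit.QuantumFields.BalabanUV.Beta.D1BFx.RProjectorRange (tsum_gq_mul_Pker tsum_Pker_mul_Pker summable_of_blk_majorant)

noncomputable section

variable {d : ℕ}

/-! ## §1 The row of `P·Δ^η` is a function of the block of its column -/

/-- [folklore] **`P·Δ′_a` from the left**: `Σ_{q ∈ nbhd r} P(p,q)·Δ′_a(q,r) = (n+1)^{−d}·(G′Q′*C)(p, blk r)` (the EL identity
`RProjector.sum_AX_mul_Pker`, transposed with `AX_symm`, `Pker_symm`). -/
theorem sum_Pker_mul_AX (n : ℕ) {a : ℝ} (ha : 0 < a) (p r : X d) :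
    ∑ q ∈ nbhd n r, Pker n a p q * AX n a q r = (((n : ℝ) + 1) ^ d)⁻¹ * kerP n a p (blk n r) := by
  rw [← sum_AX_mul_Pker n ha r p]
  exact Finset.sum_congr rfl fun q _ => by rw [AX_symm n a q r, Pker_symm n ha p q, mul_comm]

/-- [folklore] The `aQ′*Q′` part from the left: `Σ_{q ∈ nbhd r} P(p,q)·1[blk q = blk r] = Σ_{q ∈ B(blk r)} P(p,q)`. -/
theorem sum_Pker_mul_sameBlk (n : ℕ) (a : ℝ) (p r : X d) :
    ∑ q ∈ nbhd n r, Pker n a p q * sameBlk n q r = ∑ q ∈ B n (blk n r), Pker n a p q := by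
  classical
  have hsub : B n (blk n r) ⊆ nbhd n r := fun q hq => by
    simp only [nbhd, Finset.mem_union]; exact Or.inl (Or.inl hq)
  rw [← Finset.sum_subset hsub (fun q _ hq => by
    rw [sameBlk, if_neg (fun h => hq (mem_B.2 h)), mul_zero])]
  exact Finset.sum_congr rfl fun q hq => by rw [sameBlk, if_pos (mem_B.1 hq), mul_one]

/-- [our object] **THE COARSE-FACTORED ROW OF `P·(−Δ)`**: `lapRow n a p y := (n+1)^{−2}·((n+1)^{−d}·(G′Q′*C)(p,y) − a(n+1)^{−d}·Σ_{q ∈ B(y)} P(p,q))`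
— a function of the fine ROW index `p` and of a COARSE index `y` only. -/
def lapRow (n : ℕ) (a : ℝ) (p y : X d) : ℝ :=
  (((n : ℝ) + 1) ^ 2)⁻¹ * ((((n : ℝ) + 1) ^ d)⁻¹ * kerP n a p y - a / ((n : ℝ) + 1) ^ d * ∑ q ∈ B n y, Pker n a p q)

/-- [folklore] **`P·(−Δ)` FACTORS THROUGH THE BLOCK OF ITS COLUMN**: `Σ_{q ∈ nbhd r} P(p,q)·(−Δ)(q,r) = lapRow n a p (blk n r)` — from
`Δ′_a = (n+1)²(−Δ) + a(n+1)^{−d}·1[same block]` and the two identities above. -/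
theorem sum_Pker_mul_lapKer (n : ℕ) {a : ℝ} (ha : 0 < a) (p r : X d) :
    ∑ q ∈ nbhd n r, Pker n a p q * lapKer q r = lapRow n a p (blk n r) := by
  have hn : ((n : ℝ) + 1) ^ 2 ≠ 0 := by positivity
  have hA := sum_Pker_mul_AX n ha p r
  have hS := sum_Pker_mul_sameBlk n a p r
  have e : ∀ q ∈ nbhd n r, Pker n a p q * lapKer q r
      = (((n : ℝ) + 1) ^ 2)⁻¹ * (Pker n a p q * AX n a q r - a / ((n : ℝ) + 1) ^ d * (Pker n a p q * sameBlk n q r)) := by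
    intro q _
    rw [AX]; field_simp; ring
  rw [Finset.sum_congr rfl e, ← Finset.mul_sum, Finset.sum_sub_distrib, ← Finset.mul_sum, hA, hS, lapRow]

/-- [folklore] Window form: for any finite window `W ⊇ nbhd r` the same sum over `W` (the Laplacian column of `r` vanishes off `nbhd r`). -/
theorem sum_Pker_mul_lapKer_of_subset (n : ℕ) {a : ℝ} (ha : 0 < a) (p r : X d) {W : Finset (X d)} (hW : nbhd n r ⊆ W) :
    ∑ q ∈ W, Pker n a p q * lapKer q r = lapRow n a p (blk n r) := by
  rw [← sum_Pker_mul_lapKer n ha p r]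
  exact (Finset.sum_subset hW (fun q _ hq => by
    rw [lapKer_symm q r, lapKer_eq_zero_of_not_mem hq, mul_zero])).symm

/-- [folklore] `tsum` form: `Σ'_q P(p,q)·(−Δ)(q,r) = lapRow n a p (blk n r)` (a finite sum in disguise). -/
theorem tsum_Pker_mul_lapKer (n : ℕ) {a : ℝ} (ha : 0 < a) (p r : X d) :
    ∑' q : X d, Pker n a p q * lapKer q r = lapRow n a p (blk n r) := by
  rw [tsum_eq_sum (s := nbhd n r) (fun q hq => by
    rw [lapKer_symm q r, lapKer_eq_zero_of_not_mem hq, mul_zero])]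
  exact sum_Pker_mul_lapKer n ha p r

/-- [folklore] **BLOCK-CONSTANCY OF THE ROW OF `P·(−Δ)`**: two columns in the same block give the same entry. -/
theorem tsum_Pker_mul_lapKer_eq_of_blk_eq (n : ℕ) {a : ℝ} (ha : 0 < a) (p : X d) {r r' : X d} (h : blk n r = blk n r') :
    ∑' q : X d, Pker n a p q * lapKer q r = ∑' q : X d, Pker n a p q * lapKer q r' := by
  rw [tsum_Pker_mul_lapKer n ha, tsum_Pker_mul_lapKer n ha, h]

/-! ## §2 The operator corollary: `P·(−Δ)λ = 0` for block-mean-free `λ` -/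

/-- [folklore] **`P·(−Δ)·λ = 0`** for every finitely supported `λ` (support in `S`) with VANISHING BLOCK SUMS: `Σ_{r ∈ S} (P(−Δ))(p,r)·λ(r) = 0`
(the row is block-constant in `r`; block-constant rows are orthogonal to `N(Q′)`, `B5Hk103ScalarZd.sum_mul_blockConst_eq_zero`). -/
theorem sum_tsum_Pker_mul_lapKer_mul_eq_zero (n : ℕ) {a : ℝ} (ha : 0 < a) (S : Finset (X d)) (lam : X d → ℝ)
    (hS : ∀ r ∉ S, lam r = 0) (hQ : ∀ y : X d, ∑ r ∈ B n y, lam r = 0) (p : X d) :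
    ∑ r ∈ S, (∑' q : X d, Pker n a p q * lapKer q r) * lam r = 0 := by
  have h := sum_mul_blockConst_eq_zero S lam hS hQ (fun y : X d => lapRow n a p y)
  rw [← h]
  exact Finset.sum_congr rfl fun r _ => by rw [tsum_Pker_mul_lapKer n ha p r, mul_comm]

/-! ## §3 Companions in the left-acting shape (one import for brick Q3b) -/

/-- [folklore] **`P·(G′Q′*) = G′Q′*`** from the left: `Σ'_q P(p,q)·(G′Q′*)(q,y) = (G′Q′*)(p,y)` (`RProjectorRange.tsum_gq_mul_Pker` + `Pker_symm`). -/
theorem tsum_Pker_mul_gq (n : ℕ) {a : ℝ} (ha : 0 < a) (p y : X d) :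
    ∑' q : X d, Pker n a p q * gq n a q y = gq n a p y := by
  rw [← tsum_gq_mul_Pker n ha y p]
  exact tsum_congr fun q => by rw [Pker_symm n ha p q, mul_comm]

/-- [folklore] **The rows of `P` are summable** (from the block-structured exponential bound `RProjector.abs_Pker_le` and
`RProjectorRange.summable_of_blk_majorant`) — the row-summability input of `EntrywiseVolumeLimit.periodise₂` for brick Q3b. -/
theorem summable_Pker_row (n : ℕ) {a : ℝ} (ha : 0 < a) (p : X d) : Summable fun q : X d => Pker n a p q :=
  summable_of_blk_majorant n (deltaPP_pos d ha) (blk n p) fun r => abs_Pker_le n ha p r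

/-- [folklore] … and absolutely summable. -/
theorem summable_abs_Pker_row (n : ℕ) {a : ℝ} (ha : 0 < a) (p : X d) : Summable fun q : X d => |Pker n a p q| :=
  (summable_Pker_row n ha p).abs

end

end Summit.QuantumFields.BalabanUV.Beta.D1BFx.ProjectorKernelIdentities
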